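import Summits.AtomisticToContinuum.FouriersLaw.Theses.JunctionLocality

/-!
# `ConductanceLowerBound` / Negative: reduction to non-insulation under superadditive resistance

Negative knowledge / kill criterion for crux `stmt-AtomisticToContinuum-11749`
(`JunctionLocality.ConductanceLowerBound`, conclusion `liminf_N D_N > 0`), crux-disprover
generation 2 (2026-08-15).

Real-variable core (`conductanceLowerBound_seq_of_superadditive_frequently`): if `D_N > 0`
(`N ≥ 2`), the resistances `R_N = (N-1)/D_N` are superadditive up to a constant `C` on
`{N, M ≥ 2}` (the conclusion of the companion crux `SuperadditiveResistance`, item 11748), and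
`D_N ≥ c > 0` for INFINITELY MANY `N`, then `D_n ≥ 1/(2(2/c + 3|C| + 1))` for EVERY `n ≥ 2`
(Fekete iteration along residue classes).  Consequences, stated in the crux's own vocabulary with
the route items `SuperadditiveResistance` (A) and `PositiveConductance` (P) as hypotheses:

* `conductanceLowerBound_iff_frequently`: under (A)+(P) the crux is EQUIVALENT to its
  `limsup` form "`∃ c > 0`, `D_N ≥ c` for infinitely many `N`" — a prover holding (A) needs one
  good length scale per tail (e.g. dyadic lengths) only;
* `conductanceLowerBound_insulator_or_lowerBound`: under (A)+(P), at every parameter point the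
  response sequence EITHER tends to `0` (perfect insulator) OR obeys the crux's bound;
* `conductanceLowerBound_iff_noPerfectInsulator`: under (A)+(P) the crux is equivalent to "no
  admissible parameter point is a perfect insulator" — the sharp KILL CRITERION: a disproof of
  (C) compatible with (A) is exactly an insulator theorem `D_N → 0` for the clean pinned
  anharmonic chain, for which no mechanism is in print (De Roeck–Huveneers asymptotic
  localization gives super-polynomially SMALL, not zero, conductivity).
Nothing here closes an item.
-/

noncomputable section

namespace Summit.AtomisticToContinuum.FouriersLaw.Theorems

open MeasureTheory Filter Topology
open Literature.MathematicalPhysics.KineticTheory.HeatConduction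
open Summit.AtomisticToContinuum.FouriersLaw.Theses.JunctionLocality
  (ConductanceLowerBound SuperadditiveResistance PositiveConductance)

/-- Fekete iteration for a sequence superadditive on `{n ≥ 2}`: `k·a_n + a_r ≤ a_{kn+r}`
(`n, r ≥ 2`). [folklore] -/
theorem conductanceLowerBound_iter_superadditive {a : ℕ → ℝ}
    (h : ∀ n m : ℕ, 2 ≤ n → 2 ≤ m → a n + a m ≤ a (n + m))
    {n r : ℕ} (hn : 2 ≤ n) (hr : 2 ≤ r) : ∀ k : ℕ, (k : ℝ) * a n + a r ≤ a (k * n + r)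
  | 0 => by simp
  | k + 1 => by
    have ih := conductanceLowerBound_iter_superadditive h hn hr k
    have hkr : 2 ≤ k * n + r := le_add_left hr
    have hstep := h (k * n + r) n hkr hn
    have e : (k + 1) * n + r = k * n + r + n := by ring
    rw [e]
    push_cast
    linarith

/-- **Superadditive resistance + a frequent lower bound ⇒ a global lower bound** (sequence
level, explicit constant): `D_N > 0` (`N ≥ 2`), `R_N = (N-1)/D_N` superadditive up to `C` on
`{N, M ≥ 2}`, and `D_N ≥ c > 0` for infinitely many `N` give `D_n ≥ 1/(2(2/c + 3|C| + 1))` for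
every `n ≥ 2`.  Proof: `a_N := R_N - C` is superadditive; for `n ≥ 2` pick a good `N ≥ n + 2`,
`N = kn + r` with `2 ≤ r ≤ n + 1`, `k ≥ 1`; then `k a_n - |C| ≤ a_N ≤ (N-1)/c + |C|` and
`N - 1 ≤ 2kn`. [folklore] -/
theorem conductanceLowerBound_seq_of_superadditive_frequently {D : ℕ → ℝ} {C c : ℝ} (hc : 0 < c)
    (hpos : ∀ N : ℕ, 2 ≤ N → 0 < D N)
    (hsup : ∀ N M : ℕ, 2 ≤ N → 2 ≤ M →
      ((N : ℝ) - 1) / D N + ((M : ℝ) - 1) / D M - C ≤ ((N : ℝ) + (M : ℝ) - 1) / D (N + M))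
    (hfreq : ∀ N₀ : ℕ, ∃ N : ℕ, N₀ ≤ N ∧ c ≤ D N) :
    ∀ n : ℕ, 2 ≤ n → 1 / (2 * (2 / c + 3 * |C| + 1)) ≤ D n := by
  set a : ℕ → ℝ := fun N => ((N : ℝ) - 1) / D N - C with ha
  have hsa : ∀ n m : ℕ, 2 ≤ n → 2 ≤ m → a n + a m ≤ a (n + m) := by
    intro n m hn hm
    have := hsup n m hn hm
    simp only [ha]
    push_cast
    linarith
  intro n hn
  have hn0 : (0 : ℝ) < n := by exact_mod_cast (by omega : 0 < n)
  obtain ⟨N, hN, hcN⟩ := hfreq (n + 2)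
  set k : ℕ := (N - 2) / n with hk
  set r : ℕ := 2 + (N - 2) % n with hr
  have hdiv : n * ((N - 2) / n) + (N - 2) % n = N - 2 := Nat.div_add_mod (N - 2) n
  have hNkr : N = k * n + r := by
    rw [hk, hr]
    have : 2 ≤ N := by omega
    have := hdiv
    rw [Nat.mul_comm] at this
    omega
  have hr2 : 2 ≤ r := by omega
  have hrn : r ≤ n + 1 := by
    have := Nat.mod_lt (N - 2) (by omega : 0 < n)
    omega
  have hk1 : 1 ≤ k := by
    rw [hk]
    exact (Nat.le_div_iff_mul_le (by omega)).mpr (by simpa using (by omega : n ≤ N - 2))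
  have hDN : 0 < D N := hpos N (by omega)
  have hDr : 0 < D r := hpos r hr2
  have hDn : 0 < D n := hpos n hn
  have haN : a N ≤ ((N : ℝ) - 1) / c + |C| := by
    simp only [ha]
    have h1 : ((N : ℝ) - 1) / D N ≤ ((N : ℝ) - 1) / c :=
      div_le_div_of_nonneg_left (by
        have : (1 : ℝ) ≤ N := by exact_mod_cast (by omega : 1 ≤ N)
        linarith) hc hcN
    have h2 : -C ≤ |C| := neg_le_abs C
    linarith
  have har : -|C| ≤ a r := by
    simp only [ha]
    have h1 : 0 ≤ ((r : ℝ) - 1) / D r :=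
      div_nonneg (by
        have : (2 : ℝ) ≤ r := by exact_mod_cast hr2
        linarith) hDr.le
    have h2 : C ≤ |C| := le_abs_self C
    linarith
  have hiter := conductanceLowerBound_iter_superadditive hsa hn hr2 k
  rw [← hNkr] at hiter
  have hk1' : (1 : ℝ) ≤ k := by exact_mod_cast hk1
  have hkpos : (0 : ℝ) < k := by linarith
  have hkan : (k : ℝ) * a n ≤ ((N : ℝ) - 1) / c + 2 * |C| := by linarith
  have hN1 : (N : ℝ) - 1 ≤ 2 * k * n := by
    have h1 : (N : ℝ) = k * n + r := by rw [hNkr]; push_cast; ring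
    have h2 : (r : ℝ) ≤ n + 1 := by exact_mod_cast hrn
    nlinarith
  have han : a n ≤ 2 * n / c + 2 * |C| := by
    have h1 : (k : ℝ) * a n ≤ 2 * k * n / c + 2 * |C| := by
      have : ((N : ℝ) - 1) / c ≤ 2 * k * n / c := div_le_div_of_nonneg_right hN1 hc.le
      linarith
    have h2 : (k : ℝ) * a n ≤ k * (2 * n / c + 2 * |C|) := by
      have : 2 * (k : ℝ) * n / c + 2 * |C| ≤ k * (2 * n / c + 2 * |C|) := by
        have habs : 0 ≤ |C| := abs_nonneg C
        have : 2 * |C| ≤ k * (2 * |C|) := by nlinarith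
        have e : (k : ℝ) * (2 * n / c + 2 * |C|) = 2 * k * n / c + k * (2 * |C|) := by ring
        linarith
      linarith
    exact le_of_mul_le_mul_left h2 hkpos
  have hRn : ((n : ℝ) - 1) / D n ≤ n * (2 / c + 3 * |C| + 1) := by
    have h1 : ((n : ℝ) - 1) / D n = a n + C := by simp only [ha]; ring
    have h2 : C ≤ |C| := le_abs_self C
    have habs : 0 ≤ |C| := abs_nonneg C
    have hn1 : (1 : ℝ) ≤ n := by exact_mod_cast (by omega : 1 ≤ n)
    have e1 : 2 * (n : ℝ) / c = n * (2 / c) := by ring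
    have e2 : 3 * |C| ≤ n * (3 * |C|) := by nlinarith
    rw [h1]
    nlinarith
  have hK : 0 < 2 / c + 3 * |C| + 1 := by positivity
  have hn1 : (1 : ℝ) ≤ (n : ℝ) - 1 := by
    have : (2 : ℝ) ≤ n := by exact_mod_cast hn
    linarith
  have h3 : (n : ℝ) - 1 ≤ n * (2 / c + 3 * |C| + 1) * D n := by
    have := (div_le_iff₀ hDn).mp hRn
    linarith
  rw [div_le_iff₀ (by positivity)]
  nlinarith

/-- **Dichotomy at the sequence level**: positivity + superadditive resistance ⇒ EITHER
`D_N → 0` OR `∃ c > 0 ∃ N₁ ∀ N ≥ N₁, c ≤ D_N`. [folklore] -/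
theorem conductanceLowerBound_seq_insulator_or_lowerBound {D : ℕ → ℝ} {C : ℝ}
    (hpos : ∀ N : ℕ, 2 ≤ N → 0 < D N)
    (hsup : ∀ N M : ℕ, 2 ≤ N → 2 ≤ M →
      ((N : ℝ) - 1) / D N + ((M : ℝ) - 1) / D M - C ≤ ((N : ℝ) + (M : ℝ) - 1) / D (N + M)) :
    Tendsto D atTop (𝓝 0) ∨ ∃ c : ℝ, 0 < c ∧ ∃ N₁ : ℕ, ∀ N : ℕ, N₁ ≤ N → c ≤ D N := by
  by_cases h : ∃ c : ℝ, 0 < c ∧ ∀ N₀ : ℕ, ∃ N : ℕ, N₀ ≤ N ∧ c ≤ D N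
  · obtain ⟨c, hc, hfreq⟩ := h
    exact Or.inr ⟨_, by positivity, 2,
      conductanceLowerBound_seq_of_superadditive_frequently hc hpos hsup hfreq⟩
  · left
    push Not at h
    rw [Metric.tendsto_atTop]
    intro ε hε
    obtain ⟨N₀, hN₀⟩ := h ε hε
    refine ⟨max N₀ 2, fun N hN => ?_⟩
    have h1 : D N < ε := hN₀ N (le_of_max_le_left hN)
    have h2 : 0 < D N := hpos N (le_of_max_le_right hN)
    rw [Real.dist_eq, sub_zero, abs_of_pos h2]
    exact h1

/-- **Under (A) `SuperadditiveResistance` and (P) `PositiveConductance` the crux is equivalent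
to its `limsup` form** ("not an insulator": `∃ c > 0`, `D_N ≥ c` for infinitely many `N`).
[folklore] -/
theorem conductanceLowerBound_iff_frequently (hA : SuperadditiveResistance)
    (hP : PositiveConductance) :
    ConductanceLowerBound ↔
      ∀ ω₂ lam β γ : ℝ, 0 < ω₂ → 0 < lam → 0 < β → 0 < γ →
        (∀ (N : ℕ) (T_L T_R : ℝ), 0 < T_L → 0 < T_R → ∀ μ ν : Measure (PhaseSpace N),
          (pinnedChain ω₂ lam β γ).IsSteadyState N T_L T_R μ →
            (pinnedChain ω₂ lam β γ).IsSteadyState N T_L T_R ν → μ = ν) →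
        ∀ μ : (N : ℕ) → ℝ → ℝ → Measure (PhaseSpace N),
          (∀ (N : ℕ) (T_L T_R : ℝ), 0 < T_L → 0 < T_R →
            (pinnedChain ω₂ lam β γ).IsSteadyState N T_L T_R (μ N T_L T_R)) →
          ∀ T : ℝ, 0 < T → ∀ D : ℕ → ℝ,
            (∀ N : ℕ, Tendsto (fun δ : ℝ =>
              (pinnedChain ω₂ lam β γ).totalCurrent (μ N (T + δ / 2) (T - δ / 2)) / δ)
              (𝓝[≠] 0) (𝓝 (D N))) →
            ∃ c : ℝ, 0 < c ∧ ∀ N₀ : ℕ, ∃ N : ℕ, N₀ ≤ N ∧ c ≤ D N := by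
  constructor
  · intro h ω₂ lam β γ hω hl hβ hγ hu μ hμ T hT D hD
    obtain ⟨c, hc, N₁, hN₁⟩ := h ω₂ lam β γ hω hl hβ hγ hu μ hμ T hT D hD
    exact ⟨c, hc, fun N₀ => ⟨max N₀ N₁, le_max_left _ _, hN₁ _ (le_max_right _ _)⟩⟩
  · intro h ω₂ lam β γ hω hl hβ hγ hu μ hμ T hT D hD
    have hpos : ∀ N : ℕ, 2 ≤ N → 0 < D N := hP ω₂ lam β γ hω hl hβ hγ hu μ hμ T hT D hD
    obtain ⟨C, hsup⟩ := hA ω₂ lam β γ hω hl hβ hγ hu μ hμ T hT D hD hpos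
    obtain ⟨c, hc, hfreq⟩ := h ω₂ lam β γ hω hl hβ hγ hu μ hμ T hT D hD
    exact ⟨_, by positivity, 2,
      conductanceLowerBound_seq_of_superadditive_frequently hc hpos hsup hfreq⟩

/-- **KILL CRITERION, sharp form**: under (A)+(P), at every admissible parameter point, the
response sequence of the crux EITHER tends to `0` (the chain is a perfect thermal insulator at
that temperature) OR satisfies the crux's lower bound.  Oscillation in `N`
(`liminf D_N = 0 < limsup D_N`) is excluded by (A). [folklore] -/
theorem conductanceLowerBound_insulator_or_lowerBound (hA : SuperadditiveResistance)
    (hP : PositiveConductance) {ω₂ lam β γ : ℝ} (hω : 0 < ω₂) (hl : 0 < lam) (hβ : 0 < β)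
    (hγ : 0 < γ)
    (hu : ∀ (N : ℕ) (T_L T_R : ℝ), 0 < T_L → 0 < T_R → ∀ μ ν : Measure (PhaseSpace N),
      (pinnedChain ω₂ lam β γ).IsSteadyState N T_L T_R μ →
        (pinnedChain ω₂ lam β γ).IsSteadyState N T_L T_R ν → μ = ν)
    {μ : (N : ℕ) → ℝ → ℝ → Measure (PhaseSpace N)}
    (hμ : ∀ (N : ℕ) (T_L T_R : ℝ), 0 < T_L → 0 < T_R →
      (pinnedChain ω₂ lam β γ).IsSteadyState N T_L T_R (μ N T_L T_R))
    {T : ℝ} (hT : 0 < T) {D : ℕ → ℝ}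
    (hD : ∀ N : ℕ, Tendsto (fun δ : ℝ =>
      (pinnedChain ω₂ lam β γ).totalCurrent (μ N (T + δ / 2) (T - δ / 2)) / δ)
      (𝓝[≠] 0) (𝓝 (D N))) :
    Tendsto D atTop (𝓝 0) ∨ ∃ c : ℝ, 0 < c ∧ ∃ N₁ : ℕ, ∀ N : ℕ, N₁ ≤ N → c ≤ D N := by
  have hpos : ∀ N : ℕ, 2 ≤ N → 0 < D N := hP ω₂ lam β γ hω hl hβ hγ hu μ hμ T hT D hD
  obtain ⟨C, hsup⟩ := hA ω₂ lam β γ hω hl hβ hγ hu μ hμ T hT D hD hpos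
  exact conductanceLowerBound_seq_insulator_or_lowerBound hpos hsup

/-- **Under (A)+(P) the crux is equivalent to the absence of perfect insulators** in the
family: `ConductanceLowerBound ↔ (… → ¬ Tendsto D atTop (𝓝 0))`.  So a refutation of the crux
that does not also refute (A) must prove `D_N → 0` for the clean pinned anharmonic chain at some
`T > 0`. [folklore] -/
theorem conductanceLowerBound_iff_noPerfectInsulator (hA : SuperadditiveResistance)
    (hP : PositiveConductance) :
    ConductanceLowerBound ↔
      ∀ ω₂ lam β γ : ℝ, 0 < ω₂ → 0 < lam → 0 < β → 0 < γ →
        (∀ (N : ℕ) (T_L T_R : ℝ), 0 < T_L → 0 < T_R → ∀ μ ν : Measure (PhaseSpace N),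
          (pinnedChain ω₂ lam β γ).IsSteadyState N T_L T_R μ →
            (pinnedChain ω₂ lam β γ).IsSteadyState N T_L T_R ν → μ = ν) →
        ∀ μ : (N : ℕ) → ℝ → ℝ → Measure (PhaseSpace N),
          (∀ (N : ℕ) (T_L T_R : ℝ), 0 < T_L → 0 < T_R →
            (pinnedChain ω₂ lam β γ).IsSteadyState N T_L T_R (μ N T_L T_R)) →
          ∀ T : ℝ, 0 < T → ∀ D : ℕ → ℝ,
            (∀ N : ℕ, Tendsto (fun δ : ℝ =>
              (pinnedChain ω₂ lam β γ).totalCurrent (μ N (T + δ / 2) (T - δ / 2)) / δ)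
              (𝓝[≠] 0) (𝓝 (D N))) →
            ¬ Tendsto D atTop (𝓝 0) := by
  constructor
  · intro h ω₂ lam β γ hω hl hβ hγ hu μ hμ T hT D hD hlim
    obtain ⟨c, hc, N₁, hN₁⟩ := h ω₂ lam β γ hω hl hβ hγ hu μ hμ T hT D hD
    have hev : ∀ᶠ N in atTop, D N < c := hlim.eventually_lt_const hc
    obtain ⟨N₂, hN₂⟩ := eventually_atTop.mp hev
    have h1 := hN₁ (max N₁ N₂) (le_max_left _ _)
    have h2 := hN₂ (max N₁ N₂) (le_max_right _ _)
    linarith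
  · intro h ω₂ lam β γ hω hl hβ hγ hu μ hμ T hT D hD
    rcases conductanceLowerBound_insulator_or_lowerBound hA hP hω hl hβ hγ hu hμ hT hD with
      hlim | hlb
    · exact absurd hlim (h ω₂ lam β γ hω hl hβ hγ hu μ hμ T hT D hD)
    · exact hlb

end Summit.AtomisticToContinuum.FouriersLaw.Theorems

end
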